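import Summits.QuantumFields.BalabanUV.T4Continuum.Support.B13ReadingsRecordRate
import Summits.QuantumFields.BalabanUV.T4Continuum.Support.SubstrateSlotsOfRecordShift

/-!
# SUBSTRATE — W-21c = L-E9c: THE O1-LETTER INSTANCE OF NE5's W1 RECORD FACE ON THE RATE ROAD AT THE COV-SHIFTED SLOTS (typer (ο7-2) ∕ Q-S22,
# NE5 owner R58 + g38-c `B13ReadingsRecordRate`): `weightedEntrywiseRate_record_balaban_rate_on` AT `slotsOfRecordShift`, `Scov := {k | k ≤ D.K}`,
# `hoff` DISCHARGED — the twin of W-21b `SubstrateO1ReadingsShift` (p236944) with `NE3Shape (minActReadings …)` REPLACED by `0 ≤ θ < 1`, the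
# per-background `LocalRate` binder `hloc` (row NE2's, for averaging towers of regular fields: `NE2FromNE3BavgBridge.localRate_regClass_of_bavg_consistent`)
# and an abstract potential-readings carrier `Rp` with `LocalRate Rp C θ`

Cell `pub-balaban`, SUBSTRATE cell, seat `b2b-balaban-substrate-p1` (gen 6).  Summits-side under the LEAN PLACEMENT RULE.  ONE application of the owner's
g38-c `B13ReadingsRecordRate.weightedEntrywiseRate_record_balaban_rate_on`, term mode, at W-21's `slotsOfRecordShift` (slot lines `slotsOfRecordShift_rawA ∕ _rawB`,
`rfl`; `rawA₀ := rawAOfRecord ιr D cc ag sg Lsl.ΓA …` read THROUGH THE TRANSPORTER, `rawB₀ := rawBOfRecordShift D ιr cc ag sg Lsl.ΓB …` — covariance one level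
deeper, R54 (1) (α)); the two covariance readings DISPLAYED in the owner's windowed shapes `ReadsTowerCovAOn ∕ ReadsTowerCovBOn {k | k ≤ D.K}` (g37-c); the
off-window agreement `hoff` DISCHARGED by W-21's aligned junk region (both runs' cov slots read `0` at every aligned `k > D.K`: `covAtOfRecord_of_lt` ×2); the datum
type `BgD` of `dom` FREE (no minimal action is read on the rate road — `dom` may be the regular real fine fields themselves); every other reading ∕ decay ∕ Lipschitz ∕
domination letter exactly as in W-21b; conclusion = W-21b's ON THE NOSE (same constant, same rate `√(max θ L⁻¹)^k`) = the `hwer` binder of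
`B13StepEndInsOp.ne5_of_record_insOp` at the shifted slots, so the row's E-ENDs re-point by one name.  Nothing re-derived.

HONEST FRAMING: rung (B)+1 of the FINITE-VOLUME T⁴ programme — NOT infinite volume, NOT a mass gap, NOT Clay; spine PROVED 0∕9; NE5 NOT PRINTED ∕ NOT
proved; `hloc` (row NE2's two-level consistency of the coefficient towers) and `hRp` (the potential readings' rate) are OPEN row inputs, DISPLAYED; the windowed
covariance readings (junction J-cov ∕ J-avg, inhabited by nobody), the Δ∕Γ∕pot readings and every decay ∕ Lipschitz ∕ domination letter stay DISPLAYED — the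
readings are the owner's (R41∕R43); nothing of Bałaban's is asserted, no estimate is proved here.  HONEST DEPENDENCY (cell line, verbatim): continuum YM on T⁴ ⇐
BetaPertH ∧ nine spine estimates (0/9 proved); BetaPertH ⇐ (D1) ∧ (D4) ∧ CAP+tail; G-an2-4 gates asym, D1 and NE2/3/4.
-/

noncomputable section

open scoped BigOperators ComplexConjugate Matrix Matrix.Norms.L2Operator Kronecker

namespace Summit.QuantumFields.BalabanUV.T4Continuum.SubstrateO1ReadingsShiftRate


open _root_.MeasureTheory
open Summit.QuantumFields.BalabanUV.T4Continuum
open Summit.QuantumFields.BalabanUV.T4Continuum.B13OpDatum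
open Summit.QuantumFields.BalabanUV.T4Continuum.B13OpDatumJunctions (WeightedEntrywiseRate)
open Summit.QuantumFields.BalabanUV.T4Continuum.B13ReadingsDecay (ReadsTowerCovA ReadsTowerCovB CovWeightDominatesDist)
open Summit.QuantumFields.BalabanUV.T4Continuum.B13ReadingsImage
open Summit.QuantumFields.BalabanUV.T4Continuum.B13ReadingsLocal (PotQLipschitzReading PotRLipschitzReading)
open Summit.QuantumFields.BalabanUV.T4Continuum.B13ReadingsAssembly (CpertRec)
open Summit.QuantumFields.BalabanUV.T4Continuum.B13ReadingsRecord
open Summit.QuantumFields.BalabanUV.T4Continuum.B13ReadingsLevelWindow (ReadsTowerCovAOn ReadsTowerCovBOn)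
open Summit.QuantumFields.BalabanUV.T4Continuum.B13ReadingsRecordWindow
open Summit.QuantumFields.BalabanUV.T4Continuum.B13ReadingsRecordRate
open Summit.QuantumFields.BalabanUV.T4Continuum.DecayRateInterpolation (EntryDecay)
open Summit.QuantumFields.BalabanUV.T4Continuum.B13StepTermLabels (InnerLabel)
open Summit.QuantumFields.BalabanUV.T4Continuum.B13InnerData (Bnd)
open Summit.QuantumFields.BalabanUV.T4Continuum.B13StepOfRecord (Slots assembly)
open Summit.QuantumFields.BalabanUV.T4Continuum.B13Carriers (TwoRuns)
open Summit.QuantumFields.BalabanUV.T4Continuum.B13HistMeasurable (MeasPotFrame B13HistM)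
open Summit.QuantumFields.BalabanUV.T4Continuum.CovariantBlockAveraging (ContourSystem)
open Summit.QuantumFields.BalabanUV.T4Continuum.SubstrateBackgroundTransporters (unitMod)
open Summit.QuantumFields.BalabanUV.T4Continuum.SubstrateTwoRunsDriven (DrivenRuns)
open Summit.QuantumFields.BalabanUV.T4Continuum.SubstrateRawSpecies
open Summit.QuantumFields.BalabanUV.T4Continuum.SubstrateSlotsOfRecord
open Summit.QuantumFields.BalabanUV.T4Continuum.SubstrateSlotsOfRecordShift
open Literature.MathematicalPhysics.QuantumFieldTheory.Balaban1983to89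
open Literature.MathematicalPhysics.QuantumFieldTheory.Balaban1983to89.B5Prop11Plancherel (Cst Cst_nonneg Tor fine)
open Literature.MathematicalPhysics.QuantumFieldTheory.Balaban1983to89.B5G183RateUnitTower (lev lev_neZero)
open Literature.MathematicalPhysics.QuantumFieldTheory.Balaban1983to89.T4EtaRateMin (Readings LocalRate NE3Shape)
open Summit.QuantumFields.BalabanUV.T4Continuum.BalabanAveragedTowerUnit (idx Qlev)
open Summit.QuantumFields.BalabanUV.T4Continuum.BackgroundResolventTower
open Summit.QuantumFields.BalabanUV.T4Continuum.KingPairingPlantedLaw (calDalev JpcT CJ CJ_nonneg)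
open Summit.QuantumFields.BalabanUV.T4Continuum.GramPerturbationLaw (C2gram)
open Summit.QuantumFields.BalabanUV.T4Continuum.NE2FromNE3 (bgReadings)
open Summit.QuantumFields.BalabanUV.T4Continuum.NE2ColourPerturbedLayer (pertCovC)
open Summit.QuantumFields.BalabanUV.T4Continuum.RegularBackgroundTower (RegularTransporters regClass betaNE3)
open Summit.QuantumFields.BalabanUV.T4Continuum.GaugeTermScalarData (QuT Q1)
open Summit.QuantumFields.BalabanUV.T4Continuum.RegularSiteTransporters (siteT)
open Summit.QuantumFields.BalabanUV.T4Continuum.NestedContourTransport (theta0)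
open Summit.QuantumFields.BalabanUV.T4Continuum.NE2BalabanRoot (balabanPert)
open Summit.QuantumFields.BalabanUV.T4Continuum.NE2BalabanGauge (gaugeSlot liftR)
open Summit.QuantumFields.BalabanUV.T4Continuum.NE2BalabanLayerSharp (kappaBs C2Bs KstarR)
open Summit.QuantumFields.BalabanUV.T4Continuum.NE2BalabanWiring (epsR CdeltaR epsR_nonneg)
open Summit.QuantumFields.BalabanUV.T4Continuum.NE2BalabanFinal (tauR kappa4F C4F)
open Summit.QuantumFields.BalabanUV.T4Continuum.NE2BalabanThreshold (etaStar smallness_of_le)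
open Summit.QuantumFields.BalabanUV.T4Continuum.NE2FromNE3Carrier (ne2Loc)
open Summit.QuantumFields.BalabanUV.T4Continuum.MinimalActionRate (minActReadings)

-- the substrate's telescope for `slotsOfRecordShift` (W-21; same letters as p220104 §SlotsRecord), renamed where they would shadow the owner's
variable {G : Type} [GaugeGroup G] (D : DrivenRuns G)
variable {oc : Type} [Fintype oc] [DecidableEq oc] (ιr : G →* Matrix oc oc ℂ) (cc : ℂ) (ag : ℝ) (sg : ℕ → ℂ)
variable {T ι' Sy Ω 𝒴 : Type} (Pm : MeasPotFrame D.carriers) {IOp : Type*}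
  (𝒵 : D.carriers.Dom → InnerLabel D.carriers.Dom (Bnd D.toTwoRuns) → Type) [∀ Z j, Fintype (𝒵 Z j)] (domZ : ∀ Z j, 𝒵 Z j → D.carriers.Dom)
  (Jc : D.carriers.Dom → InnerLabel D.carriers.Dom (Bnd D.toTwoRuns) → Type) [∀ Z j, Fintype (Jc Z j)]
  (Vv : D.carriers.Dom → InnerLabel D.carriers.Dom (Bnd D.toTwoRuns) → Type) [∀ Z j, NormedAddCommGroup (Vv Z j)]
  [∀ Z j, InnerProductSpace ℝ (Vv Z j)] [∀ Z j, MeasurableSpace (Vv Z j)] [∀ Z j, BorelSpace (Vv Z j)] [∀ Z j, FiniteDimensional ℝ (Vv Z j)]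
  (mI : D.carriers.Dom → InnerLabel D.carriers.Dom (Bnd D.toTwoRuns) → Type) [∀ Z j, Fintype (mI Z j)] [∀ Z j, DecidableEq (mI Z j)]
  (Lsl : SlotLetters D (o := oc) (T := T) (ι' := ι') (S := Sy) (Ω := Ω) (𝒴 := 𝒴) Pm (IOp := IOp) 𝒵 domZ Jc Vv mI)
-- node NE3 ∕ the owner's letters
variable {d : ℕ} (L : ℕ) [NeZero L] (M : Fin d → ℕ) [hM : ∀ μ, NeZero (M μ)] (a : ℝ) (ha : 0 < a)
variable {o : Type*} [Fintype o] [DecidableEq o] {α β C a' η : ℝ} {m : Type*} [Fintype m] [DecidableEq m] {BgD ιp Xp : Type*}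

/-- [folklore] **THE O1-LETTER INSTANCE ON THE RATE ROAD AT THE COV-SHIFTED SLOTS** (W-21c; typer (ο7-2), NE5 owner R58 ∕ g38-c): the owner's rate-road
record face `B13ReadingsRecordRate.weightedEntrywiseRate_record_balaban_rate_on` AT `slotsOfRecordShift` (W-21) with `Scov := {k | k ≤ D.K}` — binders = W-21b's
with `hNE3` REPLACED by `hθ0 : 0 ≤ θ`, `hθ1 : θ < 1`, `hloc : ∀ V ∈ dom, LocalRate (bgReadings L M (regClass L M (liftR L M (RgV V)))) C θ` (row NE2's binder) and the
abstract potential-readings carrier `{Rp : Readings ιp Xp} (hRp : LocalRate Rp C θ)` read by `hQ`∕`hR`; `dom : Set BgD` for a FREE datum type `BgD`; `hoff` DISCHARGED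
(both cov slots read `0` above `D.K`).  Conclusion = W-21b's at the shifted slots, verbatim. -/
theorem weightedEntrywiseRate_slotsOfRecordShift_balaban_rate
    {dom : Set BgD} (hL : 2 ≤ L) (hd : 1 ≤ d)
    {RgV : BgD → ((k : ℕ) → Fin d → (Tor (fine (lev L k) M) → Matrix o o ℂ))}
    (hreg : ∀ V ∈ dom, RegularTransporters L M (liftR L M (RgV V)) α β) (hα : 0 ≤ α) (hβ : 0 ≤ β) (hC : 0 ≤ C) {θ : ℝ}
    (hθ0 : 0 ≤ θ) (hθ1 : θ < 1) (hloc : ∀ V ∈ dom, LocalRate (bgReadings L M (regClass L M (liftR L M (RgV V)))) C θ)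
    {Rp : Readings ιp Xp} (hRp : LocalRate Rp C θ)
    (ha' : 0 < a') (hαη : α ≤ η) (hβη : β ≤ η) (hη : η ≤ etaStar o d a a')
    {tow : ℕ → (ℕ → ℝ) → D.toTwoRuns.carriers.BgB → ↥dom} {W : Set (ℕ → ℝ)}
    {σ : T → ((Tor (unitMod (D.F.P D.K)) × Fin (D.F.P D.K).d) × oc) → idx L M 0 × o} {dist₁ : idx L M 0 × o → idx L M 0 × o → ℝ} {B₁ δ₁ : ℝ}
    (hdec : ∀ V ∈ dom, ∀ k, EntryDecay dist₁
      (pertCovC L M a ha (balabanPert L M a (liftR L M (RgV V)) (gaugeSlot L M (RgV V) (QuT L M o (siteT L M (RgV V))) (Q1 L M o) a'))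
        1 k) B₁ δ₁)
    (hcovA : ReadsTowerCovAOn {k : ℕ | k ≤ D.K}
      (fun V : ↥dom => pertCovC L M a ha
        (balabanPert L M a (liftR L M (RgV V)) (gaugeSlot L M (RgV V) (QuT L M o (siteT L M (RgV V))) (Q1 L M o) a')) 1)
      σ tow (fun g U k => (rawAOfRecord ιr D cc ag sg Lsl.ΓA Lsl.dkA Lsl.gcA Lsl.pQA Lsl.pRA) g (D.toTwoRuns.carriers.transport U) k) W)
    (hcovB : ReadsTowerCovBOn {k : ℕ | k ≤ D.K}
      (fun V : ↥dom => pertCovC L M a ha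
        (balabanPert L M a (liftR L M (RgV V)) (gaugeSlot L M (RgV V) (QuT L M o (siteT L M (RgV V))) (Q1 L M o) a')) 1)
      σ tow (rawBOfRecordShift D ιr cc ag sg Lsl.ΓB Lsl.dkB Lsl.gcB Lsl.pQB Lsl.pRB) W)
    (hdom₁ : CovWeightDominatesDist (slotsOfRecordShift D ιr cc ag sg Pm 𝒵 domZ Jc Vv mI Lsl).F dist₁ σ (δ₁ / 2))
    {S₂ : Set (Matrix (idx L M 0 × o) (idx L M 0 × o) ℂ)} {Φ : T → Matrix (idx L M 0 × o) (idx L M 0 × o) ℂ → Matrix m m ℂ}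
    {Λ₂ : ℝ} (hΦ : ∀ t, OpLipschitzOn S₂ (Φ t) Λ₂) (hΛ₂ : 0 ≤ Λ₂)
    (hS₂ : ∀ V ∈ dom, ∀ k, pertCovC L M a ha
      (balabanPert L M a (liftR L M (RgV V)) (gaugeSlot L M (RgV V) (QuT L M o (siteT L M (RgV V))) (Q1 L M o) a')) 1 k ∈ S₂)
    {dist₂ : m → m → ℝ} {B₂ δ₂ : ℝ}
    (hdecΦ : ∀ V ∈ dom, ∀ t k, EntryDecay dist₂ (Φ t (pertCovC L M a ha
      (balabanPert L M a (liftR L M (RgV V)) (gaugeSlot L M (RgV V) (QuT L M o (siteT L M (RgV V))) (Q1 L M o) a')) 1 k)) B₂ δ₂)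
    {σX : T → ι' → m}
    (hΔA : ReadsTowerDeltaA (fun (V : ↥dom) t k => Φ t (pertCovC L M a ha
      (balabanPert L M a (liftR L M (RgV V)) (gaugeSlot L M (RgV V) (QuT L M o (siteT L M (RgV V))) (Q1 L M o) a')) 1 k))
      σX tow (fun g U k => (rawAOfRecord ιr D cc ag sg Lsl.ΓA Lsl.dkA Lsl.gcA Lsl.pQA Lsl.pRA) g (D.toTwoRuns.carriers.transport U) k) W)
    (hΔB : ReadsTowerDeltaB (fun (V : ↥dom) t k => Φ t (pertCovC L M a ha
      (balabanPert L M a (liftR L M (RgV V)) (gaugeSlot L M (RgV V) (QuT L M o (siteT L M (RgV V))) (Q1 L M o) a')) 1 k))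
      σX tow (rawBOfRecordShift D ιr cc ag sg Lsl.ΓB Lsl.dkB Lsl.gcB Lsl.pQB Lsl.pRB) W)
    (hdom₂ : DeltaWeightDominatesDist (slotsOfRecordShift D ιr cc ag sg Pm 𝒵 domZ Jc Vv mI Lsl).F dist₂ σX (δ₂ / 2))
    {S₃ : Set (Matrix (idx L M 0 × o) (idx L M 0 × o) ℂ)} {Ψ : T → Matrix (idx L M 0 × o) (idx L M 0 × o) ℂ → Matrix m m ℂ}
    {Λ₃ : ℝ} (hΨ : ∀ t, OpLipschitzOn S₃ (Ψ t) Λ₃) (hΛ₃ : 0 ≤ Λ₃)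
    (hS₃ : ∀ V ∈ dom, ∀ k, pertCovC L M a ha
      (balabanPert L M a (liftR L M (RgV V)) (gaugeSlot L M (RgV V) (QuT L M o (siteT L M (RgV V))) (Q1 L M o) a')) 1 k ∈ S₃)
    {dist₃ : m → m → ℝ} {B₃ δ₃ : ℝ}
    (hdecΨ : ∀ V ∈ dom, ∀ t k, EntryDecay dist₃ (Ψ t (pertCovC L M a ha
      (balabanPert L M a (liftR L M (RgV V)) (gaugeSlot L M (RgV V) (QuT L M o (siteT L M (RgV V))) (Q1 L M o) a')) 1 k)) B₃ δ₃)
    {σB : T → ((Tor (unitMod (D.F.P D.K)) × Fin (D.F.P D.K).d) × oc) → m}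
    (hΓA : ReadsTowerGammaA (fun (V : ↥dom) t k => Ψ t (pertCovC L M a ha
      (balabanPert L M a (liftR L M (RgV V)) (gaugeSlot L M (RgV V) (QuT L M o (siteT L M (RgV V))) (Q1 L M o) a')) 1 k))
      σB σX tow (fun g U k => (rawAOfRecord ιr D cc ag sg Lsl.ΓA Lsl.dkA Lsl.gcA Lsl.pQA Lsl.pRA) g (D.toTwoRuns.carriers.transport U) k) W)
    (hΓB : ReadsTowerGammaB (fun (V : ↥dom) t k => Ψ t (pertCovC L M a ha
      (balabanPert L M a (liftR L M (RgV V)) (gaugeSlot L M (RgV V) (QuT L M o (siteT L M (RgV V))) (Q1 L M o) a')) 1 k))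
      σB σX tow (rawBOfRecordShift D ιr cc ag sg Lsl.ΓB Lsl.dkB Lsl.gcB Lsl.pQB Lsl.pRB) W)
    (hdom₃ : GammaWeightDominatesDist (slotsOfRecordShift D ιr cc ag sg Pm 𝒵 domZ Jc Vv mI Lsl).F dist₃ σB σX (δ₃ / 2))
    {Λ₄ Λ₅ : ℝ} (hΛ₄ : 0 ≤ Λ₄) (hΛ₅ : 0 ≤ Λ₅)
    (hQ : PotQLipschitzReading Rp (slotsOfRecordShift D ιr cc ag sg Pm 𝒵 domZ Jc Vv mI Lsl).F
      (fun g U k => (rawAOfRecord ιr D cc ag sg Lsl.ΓA Lsl.dkA Lsl.gcA Lsl.pQA Lsl.pRA) g (D.toTwoRuns.carriers.transport U) k) (rawBOfRecordShift D ιr cc ag sg Lsl.ΓB Lsl.dkB Lsl.gcB Lsl.pQB Lsl.pRB) W Λ₄)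
    (hR : PotRLipschitzReading Rp (slotsOfRecordShift D ιr cc ag sg Pm 𝒵 domZ Jc Vv mI Lsl).F
      (fun g U k => (rawAOfRecord ιr D cc ag sg Lsl.ΓA Lsl.dkA Lsl.gcA Lsl.pQA Lsl.pRA) g (D.toTwoRuns.carriers.transport U) k) (rawBOfRecordShift D ιr cc ag sg Lsl.ΓB Lsl.dkB Lsl.gcB Lsl.pQB Lsl.pRB) W Λ₅)
    :
    WeightedEntrywiseRate (slotsOfRecordShift D ιr cc ag sg Pm 𝒵 domZ Jc Vv mI Lsl).F (assembly (slotsOfRecordShift D ιr cc ag sg Pm 𝒵 domZ Jc Vv mI Lsl)).rawAt (slotsOfRecordShift D ιr cc ag sg Pm 𝒵 domZ Jc Vv mI Lsl).rawB W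
      (Real.sqrt (2 * B₁ * (2 * CpertRec o d L a α β C a' / (1 - max θ ((L : ℝ)⁻¹)))) +
          Real.sqrt (2 * B₂ * (Λ₂ * CpertRec o d L a α β C a')) +
          Real.sqrt (2 * B₃ * (Λ₃ * CpertRec o d L a α β C a')) +
          Λ₄ * C + Λ₅ * C)
      (fun k => Real.sqrt (max θ ((L : ℝ)⁻¹)) ^ k) :=
  weightedEntrywiseRate_record_balaban_rate_on L M a ha (slotsOfRecordShift D ιr cc ag sg Pm 𝒵 domZ Jc Vv mI Lsl)
    (slotsOfRecordShift_rawA D ιr cc ag sg Pm 𝒵 domZ Jc Vv mI Lsl) (slotsOfRecordShift_rawB D ιr cc ag sg Pm 𝒵 domZ Jc Vv mI Lsl)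
    hL hd hreg hα hβ hC hθ0 hθ1 hloc hRp ha' hαη hβη hη hdec hcovA hcovB hdom₁
    (fun k hk g _ U t p q => by
      -- OFF THE WINDOW (`D.K < k`) BOTH runs' cov slots read `0` (W-21's aligned junk region): run A one level above its top, run B shifted
      have hk' : D.K < k := Nat.lt_of_not_le fun h => hk h
      show covAtOfRecord (D.F.P D.K) ιr D.avA cc ag sg Lsl.ΓA (D.toTwoRuns.carriers.transport U).1 k t p q =
        covAtOfRecord (D.F.P (D.K + 1)) ιr D.avB cc ag sg Lsl.ΓB U.1 (k + 1) t p q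
      rw [covAtOfRecord_of_lt _ (show (D.F.P D.K).K < k from hk') t p q,
        covAtOfRecord_of_lt _ (show (D.F.P (D.K + 1)).K < k + 1 from Nat.succ_lt_succ hk') t p q])
    hΦ hΛ₂ hS₂ hdecΦ hΔA hΔB hdom₂ hΨ hΛ₃ hS₃ hdecΨ hΓA hΓB hdom₃ hΛ₄ hΛ₅ hQ hR


end Summit.QuantumFields.BalabanUV.T4Continuum.SubstrateO1ReadingsShiftRate

end
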